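import Summits.HodgeConjecture.HodgeConjecture.Theorems.VHCAbelianSchemesRoadSecantQuotientAnchorCMWeilStructure
import Summits.HodgeConjecture.HodgeConjecture.Theorems.Ring2AbelianAllTensorWeilCarriersDefs
import Literature.AlgebraicGeometry.Motives.AbelianVarietyIsogenyPairFlip
import Literature.AlgebraicGeometry.Motives.AbelianVarietyPoincareSplitting
import HarnessLib

/-!
# Road b02 (`VHCAbelianSchemesRoad`, D-0059) — lane W1 of crux `SemiregularSheafRepresentativesTwAtDiag` (item stmt-HodgeConjecture-19787),
# stub 2a″: EVERY SECANT–QUOTIENT ANCHOR IS A TENSOR POINT `J ⊗ ℚ(√−d)` OF THE ANDRÉ COLUMN, and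
# **2a″ ⟸ `TensorWeilCarriers 𝒪 3 ((d+1)²·d)` for the even `d ≥ 4`** (fact-free)

research route conditional on HC_CM; not a corollary; Q11.4-sentence-2 already refuted in dim ≥ 3.

THEOREMS ONLY (no definition, no named fact, no claim-tagged fact imported; `HC_CM` nowhere). Sequel of
`VHCAbelianSchemesRoadSecantQuotientAnchorCMWeilStructure` (p529079: the descended operator `ψ_Y = r ≫ φ_d ≫ q` on `Y = (J × Ĵ)/Ḡ`, served
classes are `E`-Weil classes of `(Y, ψ_Y)`). The André column's tensor node (`Ring2AbelianAllTensorWeilCarriersDefs`, ab-andre-2; p515880) asks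
carriers for the Weil classes of TENSOR POINTS `IsTensorPoint k p Y Ψ` — `(Y, Ψ)` `K`-isogenous to Deligne's split square `(A₁ × A₁, Ψ₀)`,
`Ψ₀(x, y) = (−p·y, x)`, through a flat isogeny pair `f₁ ≫ g₁ = [m]` with `g₁ ≫ Ψ = Ψ₀ ≫ g₁` — and its docstring sets them APART from the secant
anchors («Markman's secant sheaves live at the secant anchors, not at tensor points»). This file proves the opposite inclusion:

* §1 `isTensorPoint_of_splitOperator_descent` (abstract): for an isomorphism `φ : J ⥲ Jh`, an endomorphism `ψ` of `J × Jh` of Markman's shape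
  (`ψ ≫ p₁ = −d·(p₂ ≫ φ⁻¹)`, `ψ ≫ p₂ = p₁ ≫ φ`, `ψ² = −d`), an isogeny `q : J × Jh → Y` with quasi-inverse `r` (`q ≫ r = [N]`), `dim J = 3`,
  `dim Y = 6`: `(Y, r ≫ ψ ≫ q)` is a tensor point of type `(3, N²d)` via `f₁ = r ≫ ([N] × φ⁻¹)`, `g₁ = (𝟙 × N·φ) ≫ q` (`f₁ ≫ g₁ = [N²]`, `f₁` an
  isogeny hence flat — Görtz–Wedhorn 27.54 in the tree's `IsIsogeny.flat`; `g₁` conjugates `N·ψ` into `Ψ₀` for `p = N²d`), and its Weil plane is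
  the descent of `W(J × Jh, ψ)` (van Geemen 3.6).
* §2 `SecantQuotientDatum.exists_isTensorPoint`: with `φ = φ_Θ` (principal), `ψ = φ_d` (`weilOperator_fst ∕ _snd`), `q`, `N = d + 1`:
  **`(Y_d, ψ_Y)` is a tensor point of type `(3, (d+1)²·d)` with `A₁ = J(C)`** — the secant quotient is `K`-isogenous to `J ⊗ K`.
* §3 Consequences BY NAME: every pinned anchor `(X, θ)` is a `tensorPolarisedAnchor 3 ((d+1)²d)` and every (pinned-)served class lies in
  `tensorWeilServedClasses 3 ((d+1)²d) X θ` for the datum's `d`; hence **`AnchoredCarrierAt 𝒪 6 3 𝔄^pin 𝔖^pin ⟸ ∀ even d ≥ 4,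
  TensorWeilCarriers 𝒪 3 ((d+1)²·d)`** (`anchoredCarrierAt_secantQuotientPinned_of_tensorWeilCarriers`) and, for the crux's twisted door,
  **`stub_anchorCarrier_63_secantQuotientPinned` ⟸ ∀ even d ≥ 4, `TensorWeilTwistedCarriers 3 ((d+1)²·d)`**
  (`secantQuotientAnchorCarrier63Pinned_of_tensorWeilTwistedCarriers`); the per-datum chart form; the cell's served half and the spreading along
  pencils through a pinned-served fibre from the tensor node.

READING (census words, no action asked). The road's 2a″ and the column's tensor node are ONE problem: Bloch's «`a·z₀ + b·l₀³`» for the KNOWN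
cycles `Re ∕ Im (R + i√p·S)³` of `J ⊗ K` and its `K`-isogenous copies, with a twisted admissible carrier. Print (Markman, arXiv:2502.03415
Thm. 1.4.1, PREPRINT) supplies exactly ONE such carrier, AT a tensor point (`Y_d`), in ONE direction — so the tensor node at `(3, (d+1)²d)` is
«print at one direction of one `K`-isogenous copy of `J(C) ⊗ K`, research elsewhere», the same label as 2a″'s (G1)∕(G3). Nothing here says any
node, 2a″, a cell, K-SR♭∃, VHC, `HC_AV`, `HC_CM` or HC holds; the nodes are OPEN hypotheses by name.

References: [cite: Deligne1982HodgeCycles, §4 Thm. 4.8 (b), Lemma 4.5 and Remark 4.10] [cite: Andre1996Motifs, proof of Lemme 6.3.3 (p. 33)]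
[cite: Markman2025SecantWeil, §1.5 (p. 7), §3.2 and Thm. 1.4.1] [cite: vanGeemen1994HodgeAV, 3.6 (p. 236) and Lemma 5.2]
[cite: MumfordAV1970, §19 (Remark p. 169)] [cite: GortzWedhorn2023, Prop. 27.54 and Cor. 27.177 (2)] [cite: Bloch1972Semiregularity, Remark (7.5)]
[cite: BuchweitzFlenner2003, §5 Thm. 5.1].
-/

noncomputable section

open CategoryTheory CategoryTheory.Limits AlgebraicGeometry Topology

namespace Summit.HodgeConjecture.HodgeConjecture.Ring2.SemiregularRepresentatives

set_option linter.dupNamespace false -- the cell's namespace repeats the summit name, as in every `Ring2*` file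

open Literature.AlgebraicGeometry Literature.AlgebraicGeometry.Motives Literature.AlgebraicGeometry.Motives.AbelianVariety
open Literature.AlgebraicGeometry.HodgeTheory Literature.AlgebraicGeometry.Markman2025
open Literature.AlgebraicTopology.SingularHomology
open Summit.Ventures.HSemireg (ObjClass LocalVariationalHodgeFor)
open Summit.HodgeConjecture.HodgeConjecture.Ring2.AbelianAll (IsTensorPoint tensorPolarisedAnchor tensorWeilServedClasses
  TensorWeilCarriers TensorWeilTwistedCarriers)

/-! ## §1 Abstract: a split Weil operator of Markman's shape, descended along an isogeny with a quasi-inverse, is a tensor point -/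

section Abstract

variable {J Jh Y : AbelianVariety ℂ}

/-- **ABSTRACT TENSOR-POINT LEMMA.** Let `φ : J ⥲ Jh` be an isomorphism of abelian varieties, `ψ` an endomorphism of `J × Jh` of MARKMAN'S SHAPE
`ψ ≫ p₁ = −d·(p₂ ≫ φ⁻¹)`, `ψ ≫ p₂ = p₁ ≫ φ` (so `ψ² = −d`), `q : J × Jh → Y` an isogeny with quasi-inverse `r`, `q ≫ r = [N]`, `N, d ≥ 1`,
`dim J = 3`, `dim Y = 6`. Then `(Y, r ≫ ψ ≫ q)` is a TENSOR POINT of type `(3, N²d)` (`AbelianAll.IsTensorPoint`): the isogeny pair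
`f₁ = r ≫ ([N] × φ⁻¹) : Y → J × J`, `g₁ = (𝟙 × N·φ) ≫ q : J × J → Y` has `f₁ ≫ g₁ = [N²]`, `f₁` flat (an isogeny), and `g₁` intertwines
Deligne's `Ψ₀ = (x, y) ↦ (−N²d·y, x)` with `r ≫ ψ ≫ q`; and the Weil plane of `(Y, rψq)` in degree `6` is the descent of that of `(J × Jh, ψ)`.
[cite: Deligne1982HodgeCycles, §4 Thm. 4.8 (b) and Remark 4.10] [cite: vanGeemen1994HodgeAV, 3.6 (p. 236) and proof of Lemma 5.2]
[cite: MumfordAV1970, §19 (Remark p. 169)] [cite: GortzWedhorn2023, Prop. 27.54 and Cor. 27.177 (2)] -/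
theorem isTensorPoint_of_splitOperator_descent (φ : J ⟶ Jh) [IsIso φ] {ψ : J.prod Jh ⟶ J.prod Jh} {q : J.prod Jh ⟶ Y}
    {r : Y ⟶ J.prod Jh} {N d : ℕ} (hN : 0 < N) (hd : 0 < d) (hq : IsIsogeny q) (hqr : q ≫ r = N • 𝟙 (J.prod Jh))
    (hψ₁ : ψ ≫ AbelianVariety.fst J Jh = -((d : ℤ) • (AbelianVariety.snd J Jh ≫ inv φ)))
    (hψ₂ : ψ ≫ AbelianVariety.snd J Jh = AbelianVariety.fst J Jh ≫ φ) (hψ : ψ ≫ ψ = -(d • 𝟙 (J.prod Jh)))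
    (hJ : J.dim = 3) (hY : Y.dim = 2 * 3) (hP : Y.dim = (J.prod Jh).dim) :
    IsTensorPoint 3 (N ^ 2 * d) Y (r ≫ ψ ≫ q) ∧
      ∀ b : complexBetti Y.X (2 * 3),
        complexBetti.map q.hom.hom.hom (2 * 3) b ∈ weilClassesOf (J.prod Jh) ψ 3 d ↔ b ∈ weilClassesOf Y (r ≫ ψ ≫ q) 3 (N ^ 2 * d) := by
  -- `r ≫ q = [N]` on `Y`: cancel the epimorphism `q` on the left
  have hrq : r ≫ q = N • 𝟙 Y := by
    apply hq.cancel_left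
    rw [← Category.assoc, hqr, Preadditive.nsmul_comp, Category.id_comp, Preadditive.comp_nsmul, Category.comp_id]
  -- the quasi-inverse is an isogeny, hence flat
  have hriso : IsIsogeny r := isIsogeny_of_comp_eq_nsmul_id (K := ℂ) (by exact_mod_cast hN.ne') hrq hP
  -- `([N] × φ⁻¹) ≫ (𝟙 × N·φ) = [N]` on `J × Jh`
  have hmid : prodMap (N • 𝟙 J) (inv φ) ≫ prodMap (𝟙 J) (N • φ) = N • 𝟙 (J.prod Jh) := by
    apply prod_hom_ext
    · rw [Category.assoc, prodMap_fst, ← Category.assoc, prodMap_fst, Category.comp_id, Preadditive.nsmul_comp, Category.id_comp,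
        Preadditive.comp_nsmul, Category.comp_id]
    · rw [Category.assoc, prodMap_snd, ← Category.assoc, prodMap_snd, Category.assoc, Preadditive.comp_nsmul, IsIso.inv_hom_id,
        Preadditive.comp_nsmul, Category.comp_id, Preadditive.nsmul_comp, Category.id_comp]
  -- `(𝟙 × N·φ)` conjugates `N·ψ` into Deligne's `Ψ₀` for `p = N²d`
  have hkey : prodMap (𝟙 J) (N • φ) ≫ (N • ψ) =
      AbelianVariety.prodLift (AbelianVariety.snd J J ≫ (-(((N ^ 2 * d : ℕ) : ℤ) • 𝟙 J))) (AbelianVariety.fst J J) ≫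
        prodMap (𝟙 J) (N • φ) := by
    apply prod_hom_ext
    · rw [Category.assoc, Preadditive.nsmul_comp, hψ₁, Preadditive.comp_nsmul, Preadditive.comp_neg, Preadditive.comp_zsmul,
        ← Category.assoc, prodMap_snd, Category.assoc, Preadditive.nsmul_comp, IsIso.hom_inv_id, Preadditive.comp_nsmul,
        Category.comp_id, Category.assoc (AbelianVariety.prodLift _ _), prodMap_fst, Category.comp_id, prodLift_fst, Preadditive.comp_neg,
        Preadditive.comp_zsmul, Category.comp_id, smul_neg, ← natCast_zsmul, ← natCast_zsmul, smul_smul, smul_smul]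
      congr 2
      push_cast
      ring
    · rw [Category.assoc, Preadditive.nsmul_comp, hψ₂, Preadditive.comp_nsmul, ← Category.assoc, prodMap_fst, Category.comp_id,
        Category.assoc, prodMap_snd, ← Category.assoc, prodLift_snd, Preadditive.comp_nsmul]
  refine ⟨⟨hY, ?_, J, r ≫ prodMap (N • 𝟙 J) (inv φ), prodMap (𝟙 J) (N • φ) ≫ q, N * N, hJ, Nat.mul_pos hN hN, ?_, ?_, ?_⟩, fun b ↦ ?_⟩
  · -- `(rψq)² = −N²d`
    rw [natCast_zsmul]
    exact conj_comp_conj q r hqr hrq hψ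
  · -- `f₁ ≫ g₁ = [N²]`
    rw [Category.assoc, ← Category.assoc (prodMap _ _), hmid, Preadditive.nsmul_comp, Category.id_comp, Preadditive.comp_nsmul, hrq,
      smul_smul]
  · -- `f₁` is flat (an isogeny)
    exact (isIsogeny_comp hriso (isIsogeny_prodMap (isIsogeny_nsmul_id_of_ne_zero _ hN.ne') (isIsogeny_hom_of_iso (asIso φ).symm))).flat
  · -- `g₁` intertwines `Ψ₀` and `rψq`
    rw [Category.assoc, ← Category.assoc q, hqr, Preadditive.nsmul_comp, Category.id_comp, ← Preadditive.nsmul_comp,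
      ← Category.assoc, hkey, Category.assoc]
  · exact map_mem_weilClassesOf_iff_of_comp_eq_nsmul_comp hq (comp_conj_eq_nsmul_comp q r hqr ψ) hψ hd hN

end Abstract

/-! ## §2 The secant quotient `(Y, ψ_Y)` is a tensor point of type `(3, (d+1)²·d)` -/

namespace SecantQuotientDatum

variable (D : SecantQuotientDatum)

/-- **THE SECANT QUOTIENT IS A TENSOR POINT** (`AbelianAll.IsTensorPoint 3 ((d+1)²·d) Y ψ_Y`): `Y = (J × Ĵ)/Ḡ` with a descended operator
`ψ_Y := r ≫ φ_d ≫ q` (`q ≫ r = [d+1]`, `ψ_Y² = −(d+1)²d`) is `K`-isogenous, with Deligne's intertwining, to the SPLIT SQUARE `(J × J, Ψ₀)`,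
`Ψ₀(x, y) = (−(d+1)²d·y, x)` — i.e. to `J ⊗ K`, `K = ℚ(√−d)` — through `f₁ = r ≫ ([d+1] × φ_Θ⁻¹)`, `g₁ = (𝟙 × (d+1)φ_Θ) ≫ q` (§1 with
`φ = φ_Θ : J ⥲ Ĵ`, the principal polarisation isomorphism, and Markman's `φ_d`, `weilOperator_fst ∕ _snd`); and its Weil plane is the descent
of that of `(J × Ĵ, φ_d)`. So EVERY secant–quotient anchor is a TENSOR POINT of the André column with `A₁ = J(C)` — correcting the aside of
`Ring2AbelianAllTensorWeilCarriersDefs` («Markman's secant sheaves live at the secant anchors, not at tensor points»): print's ONE carrier lives AT a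
tensor point. [cite: Deligne1982HodgeCycles, §4 Thm. 4.8 (b) and Remark 4.10] [cite: Markman2025SecantWeil, §1.5 (p. 7) and §3.2]
[cite: vanGeemen1994HodgeAV, 3.6 (p. 236)] [cite: MumfordAV1970, §19 (Remark p. 169)] -/
theorem exists_isTensorPoint :
    ∃ ψY : D.Y ⟶ D.Y, IsTensorPoint 3 ((D.d + 1) ^ 2 * D.d) D.Y ψY ∧
      ∀ b : complexBetti D.Y.X (2 * 3),
        complexBetti.map D.q.hom.hom.hom (2 * 3) b ∈ weilClassesOf D.P D.ψ 3 D.d ↔ b ∈ weilClassesOf D.Y ψY 3 ((D.d + 1) ^ 2 * D.d) := by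
  haveI := D.𝒥.J.isIso_phiTheta_of_KTheta_eq_bot D.isAmple D.KTheta_eq_bot
  obtain ⟨r, hr⟩ := D.exists_q_comp_eq_nsmul_id
  exact ⟨r ≫ D.ψ ≫ D.q, isTensorPoint_of_splitOperator_descent (D.𝒥.J.phiTheta D.Θ D.isAmple) (Nat.succ_pos D.d)
    (by have := D.four_le; omega) D.isIsogeny_q hr (weilOperator_fst D.isAmple D.KTheta_eq_bot D.d)
    (weilOperator_snd D.isAmple D.KTheta_eq_bot D.d) D.ψ_comp_ψ_nsmul D.dim_J D.dim_Y (D.dim_Y.trans D.dim_P.symm)⟩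

end SecantQuotientDatum

/-! ## §3 Consequences by name: pinned anchors are tensor anchors; 2a″ ⟸ the tensor node -/

section Consequences

variable {X : SchemeOver ℂ} {θ : complexBetti X 2} {γ : complexBetti X (2 * 3)}

/-- **A (v3-)served class is a Weil class of a TENSOR structure on the anchor, and the anchor is a polarised TENSOR ANCHOR** of type
`(3, (d+1)²·d)` for the datum's even `d ≥ 4`. [cite: Deligne1982HodgeCycles, §4 Thm. 4.8 (b)] [cite: Markman2025SecantWeil, §1.5 and Thm. 1.4.1] -/
theorem IsSecantQuotientWeilClassAt.exists_tensorAnchor (h : IsSecantQuotientWeilClassAt X θ γ) :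
    ∃ d : ℕ, Even d ∧ 4 ≤ d ∧ tensorPolarisedAnchor 3 ((d + 1) ^ 2 * d) X θ ∧ γ ∈ tensorWeilServedClasses 3 ((d + 1) ^ 2 * d) X θ := by
  have hpol := h.isPolarizationClass
  obtain ⟨D, e, -, -, -, -, -, hmem⟩ := h
  obtain ⟨ψY, htp, hiff⟩ := D.exists_isTensorPoint
  exact ⟨D.d, D.even, D.four_le, ⟨⟨D.Y, ψY, htp, ⟨e.symm⟩⟩, hpol⟩, ⟨D.Y, ψY, e.symm, htp, (hiff _).1 hmem⟩⟩

/-- The pinned form. [cite: Deligne1982HodgeCycles, §4 Thm. 4.8 (b)] [cite: Markman2025SecantWeil, §1.5 and Thm. 1.4.1] -/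
theorem IsSecantQuotientWeilClassAtPinned.exists_tensorAnchor (h : IsSecantQuotientWeilClassAtPinned X θ γ) :
    ∃ d : ℕ, Even d ∧ 4 ≤ d ∧ tensorPolarisedAnchor 3 ((d + 1) ^ 2 * d) X θ ∧ γ ∈ tensorWeilServedClasses 3 ((d + 1) ^ 2 * d) X θ :=
  h.toAt.exists_tensorAnchor

/-- **Every PINNED secant–quotient anchor is a polarised tensor anchor of the André column** (for some even `d ≥ 4`, of type `(3, (d+1)²d)`).
[cite: Deligne1982HodgeCycles, §4 Thm. 4.8 (b)] [cite: Andre1996Motifs, proof of Lemme 6.3.3 (p. 33)] [cite: Markman2025SecantWeil, §1.5] -/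
theorem exists_tensorPolarisedAnchor_of_secantQuotientAnchorsPinned (h : secantQuotientAnchorsPinned X θ) :
    ∃ d : ℕ, Even d ∧ 4 ≤ d ∧ tensorPolarisedAnchor 3 ((d + 1) ^ 2 * d) X θ := by
  obtain ⟨γ, hγ⟩ := h
  obtain ⟨d, hd, h4, htp, -⟩ := hγ.exists_tensorAnchor
  exact ⟨d, hd, h4, htp⟩

variable {𝒪 : ObjClass}

/-- **2a″ ⟸ THE TENSOR NODE** (door-generic body): if `TensorWeilCarriers 𝒪 3 ((d+1)²·d)` holds for every even `d ≥ 4`, then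
`AnchoredCarrierAt 𝒪 6 3 𝔄^pin 𝔖^pin`. A new edge of the §AbelianAll implication table: the road's anchored-carrier stub is an instance of the
column's carriers for Weil classes at tensor points. Nothing says the hypothesis holds. [cite: Bloch1972Semiregularity, Remark (7.5)]
[cite: Deligne1982HodgeCycles, §4 Thm. 4.8 (b) and Remark 4.10] [cite: Markman2025SecantWeil, Thm. 1.4.1 and §1.5] -/
theorem anchoredCarrierAt_secantQuotientPinned_of_tensorWeilCarriers
    (h : ∀ d : ℕ, Even d → 4 ≤ d → TensorWeilCarriers 𝒪 3 ((d + 1) ^ 2 * d)) :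
    AnchoredCarrierAt 𝒪 6 3 (fun X θ ↦ secantQuotientAnchorsPinned X θ) (fun X θ ↦ secantQuotientServedClassesPinned X θ) := by
  intro X θ _ w hw hwQ
  obtain ⟨d, hd, h4, htp, hts⟩ := IsSecantQuotientWeilClassAtPinned.exists_tensorAnchor hw
  exact h d hd h4 X θ htp w hts hwQ

/-- The same for v3's un-pinned data `(secantQuotientAnchors, secantQuotientServedClasses)`. [cite: Bloch1972Semiregularity, Remark (7.5)]
[cite: Deligne1982HodgeCycles, §4 Thm. 4.8 (b)] -/
theorem anchoredCarrierAt_secantQuotient_of_tensorWeilCarriers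
    (h : ∀ d : ℕ, Even d → 4 ≤ d → TensorWeilCarriers 𝒪 3 ((d + 1) ^ 2 * d)) :
    AnchoredCarrierAt 𝒪 6 3 (fun X θ ↦ secantQuotientAnchors X θ) (fun X θ ↦ secantQuotientServedClasses X θ) := by
  intro X θ _ w hw hwQ
  obtain ⟨d, hd, h4, htp, hts⟩ := IsSecantQuotientWeilClassAt.exists_tensorAnchor hw
  exact h d hd h4 X θ htp w hts hwQ

/-- **THE STUB `stub_anchorCarrier_63_secantQuotientPinned` ⟸ THE TWISTED TENSOR NODES**: if `TensorWeilTwistedCarriers 3 ((d+1)²·d)` holds for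
every even `d ≥ 4`, then `SecantQuotientAnchorCarrier63Pinned C` for every `C`. [cite: Bloch1972Semiregularity, Remark (7.5)]
[cite: Markman2025SecantWeil, Thm. 1.4.1, §1.5 and §7.3] [cite: Deligne1982HodgeCycles, §4 Thm. 4.8 (b)] -/
theorem secantQuotientAnchorCarrier63Pinned_of_tensorWeilTwistedCarriers
    (h : ∀ d : ℕ, Even d → 4 ≤ d → TensorWeilTwistedCarriers 3 ((d + 1) ^ 2 * d)) (C : ChernCharacterBetti) :
    SecantQuotientAnchorCarrier63Pinned C :=
  anchoredCarrierAt_secantQuotientPinned_of_tensorWeilCarriers fun d hd h4 ↦ h d hd h4 C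

/-- v3's (a′) likewise. [cite: Bloch1972Semiregularity, Remark (7.5)] [cite: Markman2025SecantWeil, Thm. 1.4.1 and §7.3] -/
theorem secantQuotientAnchorCarrier63_of_tensorWeilTwistedCarriers
    (h : ∀ d : ℕ, Even d → 4 ≤ d → TensorWeilTwistedCarriers 3 ((d + 1) ^ 2 * d)) (C : ChernCharacterBetti) :
    SecantQuotientAnchorCarrier63 C :=
  anchoredCarrierAt_secantQuotient_of_tensorWeilCarriers fun d hd h4 ↦ h d hd h4 C

/-- **Per datum, on a chart**: `TensorWeilCarriers 𝒪 3 ((d+1)²·d)` at the datum's `d` serves, on every chart `e : X ≅ D.Y.X`, at every polarisation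
class `θ` of `X`, every RATIONAL class `w` whose transport `q^*(e⁻¹)^*w` is a Weil class of `(J × Ĵ, φ_d)` (in particular every pinned-served
class of this datum). [cite: Bloch1972Semiregularity, Remark (7.5)] [cite: Deligne1982HodgeCycles, §4 Thm. 4.8 (b)] -/
theorem SecantQuotientDatum.exists_datum_of_tensorWeilCarriers_of_chart (D : SecantQuotientDatum)
    (h : TensorWeilCarriers 𝒪 3 ((D.d + 1) ^ 2 * D.d)) (e : X ≅ D.Y.X) (hθ : IsPolarizationClass 6 X θ) {w : complexBetti X (2 * 3)}
    (hwQ : IsRationalClass w) (hwW : complexBetti.map D.q.hom.hom.hom (2 * 3) (complexBetti.map e.inv (2 * 3) w) ∈ weilClassesOf D.P D.ψ 3 D.d) :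
    ∃ (I : Finset ℕ) (κ : (q : ℕ) → complexBetti X (2 * q)) (a : ℂ) (c : ℕ → ℂ),
      3 ∈ I ∧ 𝒪 6 X I κ ∧ a ≠ 0 ∧ κ 3 = a • w + c 3 • cupPowTwo θ 3 ∧ ∀ q ∈ I, q ≠ 3 → κ q = c q • cupPowTwo θ q := by
  obtain ⟨ψY, htp, hiff⟩ := D.exists_isTensorPoint
  exact h X θ ⟨⟨D.Y, ψY, htp, ⟨e.symm⟩⟩, hθ⟩ w ⟨D.Y, ψY, e.symm, htp, (hiff _).1 hwW⟩ hwQ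

/-- **The cell's served half on the pinned-served pencils, from the tensor nodes.** [cite: Bloch1972Semiregularity, Remark (7.5)]
[cite: vanGeemen1994HodgeAV, §2.4 and Thm. 4.11] -/
theorem under_hasServedFibre_secantQuotientPinned_of_tensorWeilCarriers
    (h : ∀ d : ℕ, Even d → 4 ≤ d → TensorWeilCarriers 𝒪 3 ((d + 1) ^ 2 * d)) :
    LefAtExceptionalRegimeAtUnder 𝒪 6 3 (HasServedFibre 6 3 (fun X θ ↦ secantQuotientAnchorsPinned X θ)
      (fun X θ ↦ secantQuotientServedClassesPinned X θ)) :=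
  under_hasServedFibre_of_anchoredCarrierAt (anchoredCarrierAt_secantQuotientPinned_of_tensorWeilCarriers h)

/-- **Spreading from the tensor nodes**: door ∧ (∀ even `d ≥ 4`, `TensorWeilCarriers 𝒪 3 ((d+1)²d)`) ⟹ on every pencil of the crux's shape
(smooth irreducible affine curve base, quasi-projective total space) with a PINNED-SERVED fibre, `W` is algebraic on EVERY fibre (PART AA-e).
[cite: BuchweitzFlenner2003, §5 Thm. 5.1] [cite: Markman2025SecantWeil, Thm. 1.5.1] [cite: Deligne1982HodgeCycles, §4 Thm. 4.8 (b)] -/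
theorem mem_algebraicClasses_of_tensorWeilCarriers_secantQuotientPinned_servedFibre {𝒳 S : SchemeOver ℂ} {f : 𝒳 ⟶ S}
    (hT : LocalVariationalHodgeFor 𝒪) (h : ∀ d : ℕ, Even d → 4 ≤ d → TensorWeilCarriers 𝒪 3 ((d + 1) ^ 2 * d))
    (hf : IsSmoothProjectiveFamily f 6) (h𝒳 : IsQuasiProjectiveOver 𝒳) (hirr : IrreducibleSpace S.left) (haff : IsAffine S.left)
    (hsm : AlgebraicGeometry.Smooth S.hom) (hdim : topologicalKrullDim S.left = 1) (W : complexBetti 𝒳 (2 * 3))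
    (hW : ∀ s : ComplexPoints S, IsRationalClass (complexBetti.map (fiberι f s) (2 * 3) W) ∧
      IsOfHodgeType 6 (fiberOver f s) (2 * 3) 3 3 (complexBetti.map (fiberι f s) (2 * 3) W))
    (hsf : HasServedFibre 6 3 (fun X θ ↦ secantQuotientAnchorsPinned X θ) (fun X θ ↦ secantQuotientServedClassesPinned X θ) f W)
    (s : ComplexPoints S) : complexBetti.map (fiberι f s) (2 * 3) W ∈ algebraicClasses (fiberOver f s) 3 :=
  mem_algebraicClasses_of_anchoredCarrierAt_of_hasServedFibre hT (anchoredCarrierAt_secantQuotientPinned_of_tensorWeilCarriers h)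
    hf h𝒳 hirr haff hsm hdim W hW hsf s

/-- **Twisted door, every `C`**: the road's binder `TwistedPerfectDoorVHC C AdmTw` and the twisted tensor nodes at `(3, (d+1)²d)`, even `d ≥ 4`,
make `W` algebraic on every fibre of every pencil of the crux's shape through a pinned-served fibre. Modulo OPEN statements by name only.
[cite: BuchweitzFlenner2003, §5 Thm. 5.1] [cite: Markman2025SecantWeil, §7.3 and Thm. 1.5.1] [cite: Pridham2024Semiregularity, Cor. 2.25 and Rem. 2.26] -/
theorem mem_algebraicClasses_of_twistedPerfectDoorVHC_of_tensorWeilTwistedCarriers_servedFibre {C : ChernCharacterBetti}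
    {𝒳 S : SchemeOver ℂ} {f : 𝒳 ⟶ S}
    (hT : TwistedPerfectDoorVHC C (fun n X₀ I E => Summit.Ventures.HSemireg.gluableSigmaAdmissible n X₀ I E ∨
      Literature.AlgebraicGeometry.HodgeTheory.bfSingleAdmissible n X₀ I E))
    (h : ∀ d : ℕ, Even d → 4 ≤ d → TensorWeilTwistedCarriers 3 ((d + 1) ^ 2 * d))
    (hf : IsSmoothProjectiveFamily f 6) (h𝒳 : IsQuasiProjectiveOver 𝒳) (hirr : IrreducibleSpace S.left) (haff : IsAffine S.left)
    (hsm : AlgebraicGeometry.Smooth S.hom) (hdim : topologicalKrullDim S.left = 1) (W : complexBetti 𝒳 (2 * 3))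
    (hW : ∀ s : ComplexPoints S, IsRationalClass (complexBetti.map (fiberι f s) (2 * 3) W) ∧
      IsOfHodgeType 6 (fiberOver f s) (2 * 3) 3 3 (complexBetti.map (fiberι f s) (2 * 3) W))
    (hsf : HasServedFibre 6 3 (fun X θ ↦ secantQuotientAnchorsPinned X θ) (fun X θ ↦ secantQuotientServedClassesPinned X θ) f W)
    (s : ComplexPoints S) : complexBetti.map (fiberι f s) (2 * 3) W ∈ algebraicClasses (fiberOver f s) 3 :=
  mem_algebraicClasses_of_tensorWeilCarriers_secantQuotientPinned_servedFibre ((twistedPerfectDoorVHC_iff_localVariationalHodgeFor C _).1 hT)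
    (fun d hd h4 ↦ h d hd h4 C) hf h𝒳 hirr haff hsm hdim W hW hsf s

end Consequences

end Summit.HodgeConjecture.HodgeConjecture.Ring2.SemiregularRepresentatives

end
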